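import Literature.Algebra.EuclideanLattices.SmoothingGaussianFourier
import Literature.Algebra.EuclideanLattices.LatticeGeometryMinkowskiSecondHermite
import Mathlib.Analysis.InnerProductSpace.PiL2
import Mathlib.Analysis.InnerProductSpace.Projection.Submodule
import HarnessLib

/-!
# Regev's hyperplane lemma: a discrete Gaussian above `√2 η_ε` is not concentrated on a hyperplane

Topic `Algebra/EuclideanLattices` (family `pqc`). Everything here is PROVED. The main result is
Lemma 3.15 of O. Regev, *On lattices, learning with errors, random linear codes, and cryptography*,
J. ACM 56 (2009), art. 34 (held as arXiv:2401.03703, §3.3, p. 21), which first appeared in the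
preliminary version of Micciancio–Regev 2004:

* `Regev2009.tsum_indicator_inner_eq_zero_le` — the core inequality
  `∑_{x ∈ L, ⟪x,u⟫ = 0} ρ_r(x) ≤ (1 + ε)/√2 · ρ_r(L)` for a unit vector `u`, `0 < ε`, `0 < r`,
  `η_ε(L) ≤ r/√2`;
* `Regev2009.discreteGaussian_toOuterMeasure_inner_eq_zero_le`,
  `Regev2009.discreteGaussian_toOuterMeasure_mem_subspace_le` — for a full-rank lattice `L ⊆ V`,
  `0 < ε`, `r ≥ √2 · η_ε(L)` and a hyperplane `u^⊥` resp. a proper subspace `H < V`,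
  `Pr_{x ∼ D_{L,r}}[x ∈ H] ≤ (1 + ε)/√2`;
* `Regev2009.le_discreteGaussian_toOuterMeasure_notMem_subspace` — the printed form: if moreover
  `ε ≤ 1/10` then `Pr_{x ∼ D_{L,r}}[x ∉ H] ≥ 1/10` (indeed `(1 + ε)/√2 ≤ 1.1/1.4 < 0.9`).

This is the probabilistic heart of Regev's reduction `GIVP_{2√n φ} ≤ DGS_φ` (Lemma 3.17, via
Cor. 3.16: `n²` samples of `D_{L,r}` contain `n` linearly independent vectors), i.e. of the
`SIVP` half of the named fact `Literature.Computability.Cryptography.regev_lwe_to_sivp_quantum`.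

## Proof (Regev's, made basis-free)

Let `u` be a unit normal of `H` and `T = stretchAlong u (√2 - 1)` the linear map stretching `V` by
the factor `√2` along `u` (`x ↦ x + (√2 - 1)⟪x, u⟫ u`), so `‖T x‖² = ‖x‖² + ⟪x, u⟫²`, `T` fixes `H`
pointwise, `det T = √2`, and `‖T⁻¹ w‖² = ‖w‖² - ⟪w, u⟫²/2 ≥ ‖w‖²/2`. Then
`ρ_r(L ∩ H) ≤ ρ_r(T L)` termwise, and by Poisson summation on the full lattice `T L`
(`tsum_gaussianFunction_eq`, Banaszczyk 1993 Lemma 1.1) with `covol(T L) = √2 · covol(L)`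
(`covolume_comap_symm_eq_abs_det_mul_covolume`, `det_stretchAlong`) and
`(T L)* = T⁻¹ L*` (self-adjointness of `T`):
`ρ_r(T L) = (√2 covol L)⁻¹ rⁿ ρ_{1/r}(T⁻¹ L*) ≤ (√2 covol L)⁻¹ rⁿ ρ_{√2/r}(L*) ≤ (√2 covol L)⁻¹ rⁿ (1 + ε)`
as `r/√2 ≥ η_ε(L)`, while `ρ_r(L) = covol(L)⁻¹ rⁿ ρ_{1/r}(L*) ≥ covol(L)⁻¹ rⁿ`. Regev phrases the
same computation with the anisotropic Gaussian `exp(-π(2x₁² + x₂² + ⋯ + xₙ²)/r²)` in coordinates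
with `u = e₁`.

## Also proved here (linear-algebra glue, folklore)

* `stretchAlong u c` (`x ↦ x + c⟪x, u⟫u`), its self-adjointness, composition rule, norm identity,
  and `det (stretchAlong u c) = 1 + c` for a unit vector `u` (diagonal in an orthonormal basis
  through `u`); the equivalence `stretchEquiv u hu t ht` (stretch by a factor `t ≠ 0`).
* `mem_dualLattice_comap_symm_iff` — for a self-adjoint automorphism `T`,
  `w ∈ (T L)* ↔ T w ∈ L*` (`T L = ZLattice.comap ℝ L T⁻¹`);
  `exists_unit_mem_orthogonal` — a proper subspace has a unit normal vector.

The covolume identity `covol(T L) = |det T| · covol(L)` is the tree's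
`covolume_comap_symm_eq_abs_det_mul_covolume` (`LatticeGeometryMinkowskiSecondHermite.lean`,
Cassels Ch. I §3), imported.

## Not here

Cor. 3.16 (`n²` independent samples of `D_{L,r}` contain `n` linearly independent vectors except
with probability `≤ n (9/10)ⁿ`) needs an iid product of `PMF`s and is proved in the sequel
`Literature/Computability/Cryptography/RegevDGSIndependence.lean` on `LWE.iidPMF`.

## References

* O. Regev, J. ACM 56 (2009), art. 34, Lemma 3.15, Cor. 3.16, Lemma 3.17 (arXiv:2401.03703 p. 21).
* D. Micciancio, O. Regev, *Worst-case to average-case reductions based on Gaussian measures*,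
  SIAM J. Comput. 37 (2007), Def. 3.1 (smoothing parameter).
* W. Banaszczyk, Math. Ann. 296 (1993), Lemma 1.1 (Poisson summation for `ρ_s`).
-/

noncomputable section

open MeasureTheory Module
open scoped Real InnerProductSpace ENNReal

namespace Literature.Algebra.EuclideanLattices

section Stretch

variable {V : Type*} [NormedAddCommGroup V] [InnerProductSpace ℝ V]

/-! ### Stretching along a vector -/

/-- The linear map `x ↦ x + c ⟪x, u⟫ u`; for a unit vector `u` this stretches `V` by the factor
`1 + c` along `u` and fixes the hyperplane `u^⊥` pointwise (Regev 2009, proof of Lemma 3.15, where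
the coordinate `x₁` is rescaled by `√2`). [folklore] -/
def stretchAlong (u : V) (c : ℝ) : V →ₗ[ℝ] V where
  toFun x := x + (c * ⟪x, u⟫_ℝ) • u
  map_add' x y := by
    rw [inner_add_left, mul_add, add_smul]
    abel
  map_smul' a x := by
    simp only [RingHom.id_apply, real_inner_smul_left, smul_add, smul_smul]
    congr 2
    ring

/-- Unfolding of `stretchAlong`. [folklore] -/
theorem stretchAlong_apply (u : V) (c : ℝ) (x : V) :
    stretchAlong u c x = x + (c * ⟪x, u⟫_ℝ) • u :=
  rfl

/-- `stretchAlong u c` fixes the vectors orthogonal to `u`. [folklore] -/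
theorem stretchAlong_of_inner_eq_zero (u : V) (c : ℝ) {x : V} (hx : ⟪x, u⟫_ℝ = 0) :
    stretchAlong u c x = x := by
  rw [stretchAlong_apply, hx, mul_zero, zero_smul, add_zero]

/-- `stretchAlong u 0` is the identity. [folklore] -/
theorem stretchAlong_zero_apply (u x : V) : stretchAlong u 0 x = x := by
  rw [stretchAlong_apply, zero_mul, zero_smul, add_zero]

/-- `stretchAlong u c` is self-adjoint: `⟪T x, y⟫ = ⟪x, T y⟫`. [folklore] -/
theorem inner_stretchAlong_left (u : V) (c : ℝ) (x y : V) :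
    ⟪stretchAlong u c x, y⟫_ℝ = ⟪x, stretchAlong u c y⟫_ℝ := by
  simp only [stretchAlong_apply, inner_add_left, inner_add_right, real_inner_smul_left,
    real_inner_smul_right, real_inner_comm u y]
  ring

/-- Composition rule for a unit vector `u`:
`stretchAlong u c ∘ stretchAlong u c' = stretchAlong u (c + c' + c c')`
(the stretch factors `1 + c` multiply). [folklore] -/
theorem stretchAlong_stretchAlong {u : V} (hu : ‖u‖ = 1) (c c' : ℝ) (x : V) :
    stretchAlong u c (stretchAlong u c' x) = stretchAlong u (c + c' + c * c') x := by
  simp only [stretchAlong_apply, inner_add_left, real_inner_smul_left, real_inner_self_eq_norm_sq,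
    hu, one_pow, mul_one, add_assoc, ← add_smul]
  congr 2
  ring

/-- Norm identity for a unit vector `u`: `‖x + c⟪x,u⟫u‖² = ‖x‖² + (2c + c²) ⟪x, u⟫²`; for
`c = √2 - 1` this is `‖x‖² + ⟪x, u⟫²`, for `c = 1/√2 - 1` it is `‖x‖² - ⟪x, u⟫²/2`
(Regev 2009, proof of Lemma 3.15). [folklore] -/
theorem norm_stretchAlong_sq {u : V} (hu : ‖u‖ = 1) (c : ℝ) (x : V) :
    ‖stretchAlong u c x‖ ^ 2 = ‖x‖ ^ 2 + (2 * c + c ^ 2) * ⟪x, u⟫_ℝ ^ 2 := by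
  rw [stretchAlong_apply, norm_add_sq_real, real_inner_smul_right, norm_smul, hu, mul_one,
    Real.norm_eq_abs, sq_abs]
  ring

/-- Stretching by a nonzero factor `t` along a unit vector `u` is a linear automorphism, with
inverse the stretch by `t⁻¹`. [folklore] -/
def stretchEquiv (u : V) (hu : ‖u‖ = 1) (t : ℝ) (ht : t ≠ 0) : V ≃ₗ[ℝ] V :=
  LinearEquiv.ofLinear (stretchAlong u (t - 1)) (stretchAlong u (t⁻¹ - 1))
    (LinearMap.ext fun x => by
      rw [LinearMap.comp_apply, stretchAlong_stretchAlong hu, LinearMap.id_apply,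
        show t - 1 + (t⁻¹ - 1) + (t - 1) * (t⁻¹ - 1) = 0 by field_simp; ring,
        stretchAlong_zero_apply])
    (LinearMap.ext fun x => by
      rw [LinearMap.comp_apply, stretchAlong_stretchAlong hu, LinearMap.id_apply,
        show t⁻¹ - 1 + (t - 1) + (t⁻¹ - 1) * (t - 1) = 0 by field_simp; ring,
        stretchAlong_zero_apply])

/-- Unfolding of `stretchEquiv`. [folklore] -/
@[simp] theorem stretchEquiv_apply (u : V) (hu : ‖u‖ = 1) (t : ℝ) (ht : t ≠ 0) (x : V) :
    stretchEquiv u hu t ht x = stretchAlong u (t - 1) x :=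
  rfl

/-- Unfolding of the inverse of `stretchEquiv`. [folklore] -/
@[simp] theorem stretchEquiv_symm_apply (u : V) (hu : ‖u‖ = 1) (t : ℝ) (ht : t ≠ 0) (x : V) :
    (stretchEquiv u hu t ht).symm x = stretchAlong u (t⁻¹ - 1) x :=
  rfl

/-- **`det (stretchAlong u c) = 1 + c`** for a unit vector `u` of a finite-dimensional space: in an
orthonormal basis through `u` the map is `diag(1 + c, 1, …, 1)`. [folklore] -/
theorem det_stretchAlong [FiniteDimensional ℝ V] {u : V} (hu : ‖u‖ = 1) (c : ℝ) :
    LinearMap.det (stretchAlong u c) = 1 + c := by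
  classical
  have hu0 : u ≠ 0 := by
    rintro rfl
    simp at hu
  have hn : 0 < finrank ℝ V := Module.finrank_pos_iff_exists_ne_zero.2 ⟨u, hu0⟩
  set i₀ : Fin (finrank ℝ V) := ⟨0, hn⟩
  have hon : Orthonormal ℝ (({i₀} : Set (Fin (finrank ℝ V))).restrict fun _ : Fin (finrank ℝ V) => u) := by
    refine orthonormal_iff_ite.2 fun i j => ?_
    have hij : i = j := Subsingleton.elim i j
    subst hij
    simp [hu]
  obtain ⟨b, hb⟩ := Orthonormal.exists_orthonormalBasis_extension_of_card_eq (𝕜 := ℝ) (E := V)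
    (by simp) hon
  have hbu : b i₀ = u := hb i₀ rfl
  have hij := orthonormal_iff_ite.1 b.orthonormal
  have hM : LinearMap.toMatrix b.toBasis b.toBasis (stretchAlong u c) =
      Matrix.diagonal fun i => if i = i₀ then 1 + c else 1 := by
    ext i j
    rw [LinearMap.toMatrix_apply, b.coe_toBasis_repr_apply, b.repr_apply_apply, b.coe_toBasis,
      stretchAlong_apply, ← hbu, inner_add_right, real_inner_smul_right, hij i j, hij j i₀, hij i i₀,
      Matrix.diagonal_apply]
    by_cases h : i = j
    · subst h
      by_cases hi : i = i₀ <;> simp [hi]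
    · have : ¬ (j = i₀ ∧ i = i₀) := fun hh => h (hh.2.trans hh.1.symm)
      by_cases hi : i = i₀
      · have hj : i₀ ≠ j := fun hj => this ⟨hj.symm, hi⟩
        have hj' : j ≠ i₀ := fun hji => hj hji.symm
        simp [hi, hj, hj']
      · simp [h, hi]
  rw [← LinearMap.det_toMatrix b.toBasis, hM, Matrix.det_diagonal, Finset.prod_ite_eq']
  simp

/-- The Gaussian weight after shrinking by `1/√2` along a unit vector dominates as
`ρ_{1/r}(T⁻¹ x) ≤ ρ_{√2/r}(x)` (`T⁻¹ = stretchAlong u (1/√2 - 1)`), since `‖T⁻¹ x‖² = ‖x‖² - ⟪x,u⟫²/2 ≥ ‖x‖²/2`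
(Regev 2009, proof of Lemma 3.15: the dual-side comparison with `ρ_{√2/r}(L*)`). [folklore] -/
theorem gaussianFunction_inv_stretchAlong_le {u : V} (hu : ‖u‖ = 1) {r : ℝ} (hr : 0 < r) (x : V) :
    gaussianFunction r⁻¹ (stretchAlong u ((Real.sqrt 2)⁻¹ - 1) x) ≤
      gaussianFunction (r / Real.sqrt 2)⁻¹ x := by
  have h2 : (0 : ℝ) < Real.sqrt 2 := Real.sqrt_pos.2 (by norm_num)
  have hsq : Real.sqrt 2 ^ 2 = 2 := Real.sq_sqrt (by norm_num)
  have hnorm := norm_stretchAlong_sq hu ((Real.sqrt 2)⁻¹ - 1) x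
  have hcoef : 2 * ((Real.sqrt 2)⁻¹ - 1) + ((Real.sqrt 2)⁻¹ - 1) ^ 2 = -(1 / 2) := by
    field_simp
    nlinarith [hsq]
  rw [hcoef] at hnorm
  have hcs : ⟪x, u⟫_ℝ ^ 2 ≤ ‖x‖ ^ 2 := by
    have h := abs_real_inner_le_norm x u
    rw [hu, mul_one] at h
    nlinarith [abs_nonneg ⟪x, u⟫_ℝ, sq_abs ⟪x, u⟫_ℝ]
  have hlow : ‖x‖ ^ 2 / 2 ≤ ‖stretchAlong u ((Real.sqrt 2)⁻¹ - 1) x‖ ^ 2 := by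
    rw [hnorm]; linarith
  rw [← one_div r, gaussianFunction_one_div, ← one_div (r / Real.sqrt 2), gaussianFunction_one_div,
    Real.exp_le_exp, div_pow, hsq]
  have hπ : 0 < π := Real.pi_pos
  nlinarith [mul_le_mul_of_nonneg_left hlow (by positivity : (0 : ℝ) ≤ π * r ^ 2)]

end Stretch

section Comap

variable {V : Type*} [NormedAddCommGroup V] [InnerProductSpace ℝ V] [FiniteDimensional ℝ V]
  [MeasurableSpace V] [BorelSpace V]

variable (L : Submodule ℤ V) [DiscreteTopology L] [IsZLattice ℝ L]

/-! ### The dual of the image lattice `T L = ZLattice.comap ℝ L T⁻¹` -/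

omit [FiniteDimensional ℝ V] [MeasurableSpace V] [BorelSpace V] [DiscreteTopology L] [IsZLattice ℝ L] in
/-- **Dual of a linear image of a lattice**, self-adjoint case: for a linear automorphism `T` with
`⟪T x, y⟫ = ⟪x, T y⟫`, the dual of the image lattice `T L` (Mathlib's pull-back
`ZLattice.comap ℝ L T⁻¹`) is `T⁻¹ L*`, i.e. `w ∈ (T L)* ↔ T w ∈ L*` (for a general `T` the
adjoint appears). [folklore] -/
theorem mem_dualLattice_comap_symm_iff (T : V ≃L[ℝ] V)
    (hT : ∀ x y : V, ⟪T x, y⟫_ℝ = ⟪x, T y⟫_ℝ) (w : V) :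
    w ∈ dualLattice (ZLattice.comap ℝ L T.symm.toLinearMap) ↔ T w ∈ dualLattice L := by
  simp only [mem_dualLattice]
  constructor
  · intro h x hx
    have hx' : T x ∈ ZLattice.comap ℝ L T.symm.toLinearMap := by
      change T.symm.toLinearMap (T x) ∈ L
      simpa using hx
    obtain ⟨n, hn⟩ := h (T x) hx'
    exact ⟨n, by rw [hn, hT]⟩
  · intro h y hy
    have hy' : T.symm y ∈ L := hy
    obtain ⟨n, hn⟩ := h (T.symm y) hy'
    refine ⟨n, ?_⟩
    rw [hn, hT, ContinuousLinearEquiv.apply_symm_apply]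

end Comap

section Hyperplane

variable {V : Type*} [NormedAddCommGroup V] [InnerProductSpace ℝ V] [FiniteDimensional ℝ V]
  [MeasurableSpace V] [BorelSpace V]

variable (L : Submodule ℤ V) [DiscreteTopology L] [IsZLattice ℝ L]

/-! ### Regev's Lemma 3.15 -/

/-- **Regev 2009, Lemma 3.15 (core inequality, hyperplane through the origin with unit normal `u`)**:
for a full-rank lattice `L`, `0 < ε`, `0 < r` with `η_ε(L) ≤ r/√2`,
`∑_{x ∈ L, ⟪x,u⟫ = 0} ρ_r(x) ≤ (1 + ε)/√2 · ρ_r(L)`. Proof: Poisson summation on the stretched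
lattice `T L`, `T = stretch by √2 along u` (see the module docstring).
[cite: Regev2009, Lemma 3.15 (proof)] -/
theorem Regev2009.tsum_indicator_inner_eq_zero_le {ε r : ℝ} (hε : 0 < ε) (hr : 0 < r)
    (hη : smoothingParameter L ε ≤ r / Real.sqrt 2) {u : V} (hu : ‖u‖ = 1) :
    ∑' x : L, {x : L | ⟪(x : V), u⟫_ℝ = 0}.indicator (fun x => gaussianFunction r (x : V)) x ≤
      (1 + ε) / Real.sqrt 2 * ∑' x : L, gaussianFunction r (x : V) := by
  classical
  have h2 : (0 : ℝ) < Real.sqrt 2 := Real.sqrt_pos.2 (by norm_num)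
  -- `T` = stretch by `√2` along `u` (`T.symm` = shrink by `1/√2`); `TL = T L = ZLattice.comap L T⁻¹`.
  set T : V ≃L[ℝ] V := (stretchEquiv u hu (Real.sqrt 2) h2.ne').toContinuousLinearEquiv with hTdef
  have hT_apply : ∀ x, T x = stretchAlong u (Real.sqrt 2 - 1) x := fun x => rfl
  have hTsymm_apply : ∀ x, T.symm x = stretchAlong u ((Real.sqrt 2)⁻¹ - 1) x := fun x => rfl
  set TL : Submodule ℤ V := ZLattice.comap ℝ L T.symm.toLinearMap with hTL
  -- (1) termwise: the hyperplane part of `ρ_r(L)` is at most `∑_{x ∈ L} ρ_r(T x)`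
  have hsumT : Summable fun x : L => gaussianFunction r (T (x : V)) := by
    have hs : Summable fun y : TL => gaussianFunction r (y : V) := by
      simpa using summable_gaussianFunction_sub TL hr.ne' (0 : V)
    have h := (Equiv.summable_iff (ZLattice.comap_equiv ℝ L T.symm.toLinearEquiv).toEquiv
      (f := fun y : TL => gaussianFunction r (y : V))).2 hs
    refine h.congr fun x => ?_
    change gaussianFunction r (((ZLattice.comap_equiv ℝ L T.symm.toLinearEquiv x : TL) : V)) = _
    rw [ZLattice.comap_equiv_apply]
    rfl
  have step1 : ∑' x : L, {x : L | ⟪(x : V), u⟫_ℝ = 0}.indicator (fun x => gaussianFunction r (x : V)) x ≤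
      ∑' x : L, gaussianFunction r (T (x : V)) := by
    refine Summable.tsum_le_tsum (fun x => ?_) ?_ hsumT
    · by_cases hx : x ∈ {x : L | ⟪(x : V), u⟫_ℝ = 0}
      · rw [Set.indicator_of_mem hx, hT_apply, stretchAlong_of_inner_eq_zero _ _ hx]
      · rw [Set.indicator_of_notMem hx]
        exact (gaussianFunction_pos _ _).le
    · refine Summable.indicator ?_ _
      simpa using summable_gaussianFunction_sub L hr.ne' (0 : V)
  -- (2) reindex `L ≃ TL`
  have step2 : ∑' x : L, gaussianFunction r (T (x : V)) = ∑' y : TL, gaussianFunction r (y : V) := by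
    rw [← Equiv.tsum_eq (ZLattice.comap_equiv ℝ L T.symm.toLinearEquiv).toEquiv]
    refine tsum_congr fun x => ?_
    change _ = gaussianFunction r (((ZLattice.comap_equiv ℝ L T.symm.toLinearEquiv x : TL) : V))
    rw [ZLattice.comap_equiv_apply]
    rfl
  -- (3) Poisson summation on `TL`
  have step3 := tsum_gaussianFunction_eq TL hr
  -- (4) covolume of `TL` (Cassels I §3: `covol(T L) = |det T| covol L`, `det T = √2`)
  have hdet : LinearMap.det (T.toLinearEquiv : V →ₗ[ℝ] V) = Real.sqrt 2 := by
    have : (T.toLinearEquiv : V →ₗ[ℝ] V) = stretchAlong u (Real.sqrt 2 - 1) := by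
      ext x; exact hT_apply x
    rw [this, det_stretchAlong hu]
    ring
  have step4 : ZLattice.covolume TL = Real.sqrt 2 * ZLattice.covolume L := by
    rw [hTL, covolume_comap_symm_eq_abs_det_mul_covolume L volume T, hdet, abs_of_pos h2]
  -- (5) the dual side: `ρ_{1/r}((TL)*) = ρ_{1/r}(T⁻¹ L*) ≤ ρ_{√2/r}(L*) ≤ 1 + ε`
  have hTadj : ∀ x y : V, ⟪T x, y⟫_ℝ = ⟪x, T y⟫_ℝ := fun x y => by
    rw [hT_apply, hT_apply, inner_stretchAlong_left]
  have step5 : ∑' w : dualLattice TL, gaussianFunction r⁻¹ (w : V) ≤ 1 + ε := by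
    -- reindex `(TL)* ≃ L*`, `w ↦ T w`
    let eD : dualLattice TL ≃ dualLattice L :=
      Equiv.subtypeEquiv T.toLinearEquiv.toEquiv fun w => mem_dualLattice_comap_symm_iff L T hTadj w
    have heD : ∀ w : dualLattice TL, ((eD w : dualLattice L) : V) = T (w : V) := fun w => rfl
    have hre : ∑' w : dualLattice TL, gaussianFunction r⁻¹ (w : V) =
        ∑' v : dualLattice L, gaussianFunction r⁻¹ (T.symm (v : V)) := by
      rw [← Equiv.tsum_eq eD]
      refine tsum_congr fun w => ?_
      rw [heD, ContinuousLinearEquiv.symm_apply_apply]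
    rw [hre]
    have hsD : Summable fun v : dualLattice L => gaussianFunction (r / Real.sqrt 2)⁻¹ (v : V) := by
      simpa using summable_gaussianFunction_sub (dualLattice L)
        (inv_ne_zero (div_pos hr h2).ne') (0 : V)
    refine (Summable.tsum_le_tsum (fun v => ?_) ?_ hsD).trans
      (tsum_gaussianFunction_dual_le_one_add L hε (div_pos hr h2) hη)
    · rw [hTsymm_apply]; exact gaussianFunction_inv_stretchAlong_le hu hr _
    · exact Summable.of_nonneg_of_le (fun v => (gaussianFunction_pos _ _).le)
        (fun v => by rw [hTsymm_apply]; exact gaussianFunction_inv_stretchAlong_le hu hr _) hsD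
  -- (6) `ρ_r(L) ≥ covol(L)⁻¹ rⁿ`
  have hcov : 0 < ZLattice.covolume L := ZLattice.covolume_pos L volume
  have step6 : (ZLattice.covolume L)⁻¹ * r ^ finrank ℝ V ≤ ∑' x : L, gaussianFunction r (x : V) := by
    rw [tsum_gaussianFunction_eq L hr]
    have h1 : (1 : ℝ) ≤ ∑' w : dualLattice L, gaussianFunction r⁻¹ (w : V) := by
      have hs : Summable fun w : dualLattice L => gaussianFunction r⁻¹ (w : V) := by
        simpa using summable_gaussianFunction_sub (dualLattice L) (inv_ne_zero hr.ne') (0 : V)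
      have := hs.le_tsum ⟨0, (dualLattice L).zero_mem⟩ fun w _ => (gaussianFunction_pos _ _).le
      simpa [gaussianFunction_zero] using this
    have hc : 0 ≤ (ZLattice.covolume L)⁻¹ * r ^ finrank ℝ V := by positivity
    nlinarith
  -- assembly
  calc ∑' x : L, {x : L | ⟪(x : V), u⟫_ℝ = 0}.indicator (fun x => gaussianFunction r (x : V)) x
      ≤ ∑' y : TL, gaussianFunction r (y : V) := step1.trans_eq step2
    _ = (ZLattice.covolume TL)⁻¹ * r ^ finrank ℝ V *
          ∑' w : dualLattice TL, gaussianFunction r⁻¹ (w : V) := step3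
    _ ≤ (ZLattice.covolume TL)⁻¹ * r ^ finrank ℝ V * (1 + ε) := by
          have : 0 ≤ (ZLattice.covolume TL)⁻¹ * r ^ finrank ℝ V := by
            rw [step4]; positivity
          exact mul_le_mul_of_nonneg_left step5 this
    _ = (1 + ε) / Real.sqrt 2 * ((ZLattice.covolume L)⁻¹ * r ^ finrank ℝ V) := by
          rw [step4]; field_simp
    _ ≤ (1 + ε) / Real.sqrt 2 * ∑' x : L, gaussianFunction r (x : V) :=
          mul_le_mul_of_nonneg_left step6 (by positivity)

/-- **Regev 2009, Lemma 3.15, hyperplane with unit normal `u`**: for a full-rank lattice `L`,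
`0 < ε` and `r ≥ √2 · η_ε(L)`, `Pr_{x ∼ D_{L,r}}[⟪x, u⟫ = 0] ≤ (1 + ε)/√2`.
[cite: Regev2009, Lemma 3.15 (proof)] -/
theorem Regev2009.discreteGaussian_toOuterMeasure_inner_eq_zero_le {ε r : ℝ} (hε : 0 < ε)
    (hη : Real.sqrt 2 * smoothingParameter L ε ≤ r) {u : V} (hu : ‖u‖ = 1) :
    (discreteGaussian L r 0).toOuterMeasure {x : L | ⟪(x : V), u⟫_ℝ = 0} ≤
      ENNReal.ofReal ((1 + ε) / Real.sqrt 2) := by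
  have h2 : (0 : ℝ) < Real.sqrt 2 := Real.sqrt_pos.2 (by norm_num)
  have hu0 : u ≠ 0 := by
    rintro rfl
    simp at hu
  haveI : Nontrivial V := nontrivial_of_ne u 0 hu0
  have hηpos : 0 < smoothingParameter L ε := smoothingParameter_pos_holds L hε
  have hr : 0 < r := lt_of_lt_of_le (mul_pos h2 hηpos) hη
  have hη' : smoothingParameter L ε ≤ r / Real.sqrt 2 := by
    rw [le_div_iff₀ h2, mul_comm]
    exact hη
  set A : Set L := {x : L | ⟪(x : V), u⟫_ℝ = 0} with hA
  have key := Regev2009.tsum_indicator_inner_eq_zero_le L hε hr hη' hu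
  have hsumρ : Summable fun x : L => gaussianFunction r (x : V) := by
    simpa using summable_gaussianFunction_sub L hr.ne' (0 : V)
  have hZ : 0 < ∑' x : L, gaussianFunction r (x : V) := by
    simpa using tsum_gaussianFunction_sub_pos L hr.ne' (0 : V)
  have hind : ∀ x : L, A.indicator (⇑(discreteGaussian L r 0)) x =
      ENNReal.ofReal (A.indicator (fun x => gaussianFunction r (x : V)) x) *
        (gaussianMass r 0 (L : Set V))⁻¹ := by
    intro x
    by_cases hx : x ∈ A
    · rw [Set.indicator_of_mem hx, Set.indicator_of_mem hx, discreteGaussian_apply L hr, sub_zero]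
    · rw [Set.indicator_of_notMem hx, Set.indicator_of_notMem hx, ENNReal.ofReal_zero, zero_mul]
  rw [PMF.toOuterMeasure_apply]
  simp_rw [hind]
  rw [ENNReal.tsum_mul_right, gaussianMass_coe_eq_ofReal_tsum L hr.ne' 0]
  simp_rw [sub_zero]
  have hnn : ∀ x : L, 0 ≤ A.indicator (fun x => gaussianFunction r (x : V)) x := fun x =>
    Set.indicator_nonneg (fun _ _ => (gaussianFunction_pos _ _).le) _
  rw [← ENNReal.ofReal_tsum_of_nonneg hnn (hsumρ.indicator _), ← ENNReal.ofReal_inv_of_pos hZ,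
    ← ENNReal.ofReal_mul (tsum_nonneg hnn), ENNReal.ofReal_le_ofReal_iff (by positivity),
    mul_inv_le_iff₀ hZ]
  exact key

omit [MeasurableSpace V] [BorelSpace V] [DiscreteTopology L] [IsZLattice ℝ L] in
/-- A proper subspace of a finite-dimensional inner product space has a unit normal vector.
[folklore] -/
theorem exists_unit_mem_orthogonal {H : Submodule ℝ V} (hH : H ≠ ⊤) :
    ∃ u : V, ‖u‖ = 1 ∧ u ∈ Hᗮ := by
  haveI : CompleteSpace H := FiniteDimensional.complete ℝ H
  have hHo : Hᗮ ≠ ⊥ := fun h => hH (Submodule.orthogonal_eq_bot_iff.1 h)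
  obtain ⟨v, hvH, hv0⟩ := Submodule.exists_mem_ne_zero_of_ne_bot hHo
  refine ⟨‖v‖⁻¹ • v, ?_, Submodule.smul_mem _ _ hvH⟩
  rw [norm_smul, norm_inv, norm_norm, inv_mul_cancel₀ (norm_ne_zero_iff.2 hv0)]

/-- **Regev 2009, Lemma 3.15 (upper-bound form)**: for a full-rank lattice `L` in `V`, `0 < ε`,
`r ≥ √2 · η_ε(L)` and a proper subspace `H < V` (i.e. `dim H ≤ n - 1`),
`Pr_{x ∼ D_{L,r}}[x ∈ H] ≤ (1 + ε)/√2`. [cite: Regev2009, Lemma 3.15] -/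
theorem Regev2009.discreteGaussian_toOuterMeasure_mem_subspace_le {ε r : ℝ} (hε : 0 < ε)
    (hη : Real.sqrt 2 * smoothingParameter L ε ≤ r) {H : Submodule ℝ V} (hH : H ≠ ⊤) :
    (discreteGaussian L r 0).toOuterMeasure {x : L | (x : V) ∈ H} ≤
      ENNReal.ofReal ((1 + ε) / Real.sqrt 2) := by
  obtain ⟨u, hu, huH⟩ := exists_unit_mem_orthogonal hH
  refine le_trans ((discreteGaussian L r 0).toOuterMeasure.mono fun x hx => ?_)
    (Regev2009.discreteGaussian_toOuterMeasure_inner_eq_zero_le L hε hη hu)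
  exact Submodule.inner_right_of_mem_orthogonal hx huH

/-- **Regev 2009, Lemma 3.15, as printed**: let `L` be an `n`-dimensional (full-rank) lattice and
`r ≥ √2 η_ε(L)` where `0 < ε ≤ 1/10`; then for any subspace `H` of dimension at most `n - 1`
(`H ≠ ⊤`), the probability that `x ∉ H` for `x ∼ D_{L,r}` is at least `1/10`.
(From the upper-bound form: `(1 + ε)/√2 ≤ 1.1/1.4 < 9/10`.) [cite: Regev2009, Lemma 3.15] -/
theorem Regev2009.le_discreteGaussian_toOuterMeasure_notMem_subspace {ε r : ℝ} (hε : 0 < ε)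
    (hε' : ε ≤ 1 / 10) (hη : Real.sqrt 2 * smoothingParameter L ε ≤ r) {H : Submodule ℝ V}
    (hH : H ≠ ⊤) :
    ENNReal.ofReal (1 / 10) ≤ (discreteGaussian L r 0).toOuterMeasure {x : L | (x : V) ∉ H} := by
  set p := discreteGaussian L r 0 with hp
  set A : Set L := {x : L | (x : V) ∈ H} with hA
  have h2 : (0 : ℝ) < Real.sqrt 2 := Real.sqrt_pos.2 (by norm_num)
  have hAle : p.toOuterMeasure A ≤ ENNReal.ofReal (9 / 10) := by
    refine (Regev2009.discreteGaussian_toOuterMeasure_mem_subspace_le L hε hη hH).trans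
      (ENNReal.ofReal_le_ofReal ?_)
    rw [div_le_iff₀ h2]
    have h14 : (1.4 : ℝ) ≤ Real.sqrt 2 := by
      rw [Real.le_sqrt (by norm_num) (by norm_num)]
      norm_num
    linarith
  have hcompl : {x : L | (x : V) ∉ H} = Aᶜ := rfl
  have hsum : p.toOuterMeasure A + p.toOuterMeasure Aᶜ = 1 := by
    rw [PMF.toOuterMeasure_apply, PMF.toOuterMeasure_apply, ← ENNReal.tsum_add]
    have h : ∀ x, A.indicator p x + Aᶜ.indicator p x = p x := fun x =>
      congrFun (Set.indicator_self_add_compl A p) x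
    simp_rw [h]
    exact p.tsum_coe
  have hAtop : p.toOuterMeasure A ≠ ∞ := ne_top_of_le_ne_top ENNReal.one_ne_top (by
    rw [← hsum]; exact le_self_add)
  rw [hcompl]
  calc ENNReal.ofReal (1 / 10) = 1 - ENNReal.ofReal (9 / 10) := by
        rw [← ENNReal.ofReal_one, ← ENNReal.ofReal_sub _ (by norm_num : (0 : ℝ) ≤ 9 / 10)]
        norm_num
    _ ≤ 1 - p.toOuterMeasure A := tsub_le_tsub_left hAle 1
    _ = p.toOuterMeasure Aᶜ := by
        rw [← hsum, ENNReal.add_sub_cancel_left hAtop]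

end Hyperplane

end Literature.Algebra.EuclideanLattices

end
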